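import Mathlib

/-!
# Crux `HilbertIntegralOverconvergentIsCongruence` (stmt-Langlands-8485), line `Sketch-ideate-r1-k1`:
# stub `stub_mvKatzSumMul` — sum families of `d`-variable Katz data are stable under products

A Katz datum in `d` variables over a nonarchimedean field `K` is packaged as its generating series
`Φ = Σ_i a_i T^i ∈ (MvPowerSeries σ K)⟦T⟧`; the SUM condition towards `G` along `Q` (the inverse of
the Hasse lift) is `HasSum (i ↦ (a_i Q^i)_n) (G_n)` for every exponent `n`.  This stub: the sum
condition is stable under products — `Φ₁ Φ₂` sums to `G₁ G₂` (Cauchy product of unconditional sums in a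
nonarchimedean ring, `HasSum.mul_of_nonarchimedean`, regrouped along the finite fibres `i + j = k`
and the finite antidiagonal of `n`).  `d`-variable analogue of the sibling line's
`CapacityClassicality.katzSumFamily_mul`.  Theorems only.
-/

set_option linter.dupNamespace false

namespace Summit.Langlands.Langlands.Theorems.HilbertIntegralOverconvergentIsCongruence

/-- **Stub `stub_mvKatzSumMul`.**  Over a nonarchimedean normed field `K`: if
`Σ_i (coeff_i Φ₁ · Q^i)_n = (G₁)_n` and `Σ_i (coeff_i Φ₂ · Q^i)_n = (G₂)_n` as `HasSum`s for every
exponent `n`, then `Σ_i (coeff_i (Φ₁ Φ₂) · Q^i)_n = (G₁ G₂)_n` for every `n`. [folklore] -/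
theorem stub_mvKatzSumMul {K σ : Type*} [NormedField K] [IsUltrametricDist K]
    (Q : MvPowerSeries σ K) (Φ₁ Φ₂ : PowerSeries (MvPowerSeries σ K)) (G₁ G₂ : MvPowerSeries σ K)
    (h₁ : ∀ n, HasSum (fun i : ℕ ↦ MvPowerSeries.coeff n (PowerSeries.coeff i Φ₁ * Q ^ i))
      (MvPowerSeries.coeff n G₁))
    (h₂ : ∀ n, HasSum (fun i : ℕ ↦ MvPowerSeries.coeff n (PowerSeries.coeff i Φ₂ * Q ^ i))
      (MvPowerSeries.coeff n G₂)) :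
    ∀ n, HasSum (fun i : ℕ ↦ MvPowerSeries.coeff n (PowerSeries.coeff i (Φ₁ * Φ₂) * Q ^ i))
      (MvPowerSeries.coeff n (G₁ * G₂)) := by
  -- adapted from `CapacityClassicality.katzSumFamily_mul` (one-variable sibling line)
  classical
  letI : NonarchimedeanRing K := ⟨NonarchimedeanAddGroup.is_nonarchimedean⟩
  intro m
  -- the Cauchy product over `ℕ × ℕ`
  have hprod : HasSum (fun ij : ℕ × ℕ ↦ MvPowerSeries.coeff m
      ((PowerSeries.coeff ij.1 Φ₁ * Q ^ ij.1) * (PowerSeries.coeff ij.2 Φ₂ * Q ^ ij.2)))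
      (MvPowerSeries.coeff m (G₁ * G₂)) := by
    have h := hasSum_sum fun (ab : (σ →₀ ℕ) × (σ →₀ ℕ))
        (_ : ab ∈ Finset.HasAntidiagonal.antidiagonal m) ↦
      (h₁ ab.1).mul_of_nonarchimedean (h₂ ab.2)
    rw [MvPowerSeries.coeff_mul]
    refine h.congr_fun fun ij ↦ ?_
    rw [MvPowerSeries.coeff_mul]
  -- regroup along `i + j = n`
  have hsig := (Finset.HasAntidiagonal.sigmaAntidiagonalEquivProd.hasSum_iff.mpr hprod).sigma
    fun n ↦ hasSum_fintype (L := SummationFilter.unconditional _) _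
  refine hsig.congr_fun fun n ↦ ?_
  simp only [Function.comp_def, Finset.HasAntidiagonal.sigmaAntidiagonalEquivProd_apply]
  rw [Finset.sum_coe_sort (Finset.HasAntidiagonal.antidiagonal n) fun ij : ℕ × ℕ ↦
    MvPowerSeries.coeff m
      ((PowerSeries.coeff ij.1 Φ₁ * Q ^ ij.1) * (PowerSeries.coeff ij.2 Φ₂ * Q ^ ij.2)),
    PowerSeries.coeff_mul n Φ₁ Φ₂, Finset.sum_mul, map_sum]
  refine Finset.sum_congr rfl fun ij hij ↦ ?_
  rw [Finset.HasAntidiagonal.mem_antidiagonal] at hij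
  rw [← hij, pow_add]
  exact congrArg (fun S ↦ MvPowerSeries.coeff m S) (by ring)

end Summit.Langlands.Langlands.Theorems.HilbertIntegralOverconvergentIsCongruence
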